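import Summits.AtomisticToContinuum.Crystallization.Theorems.ThreeConeCertificateDefs
import Literature.MathematicalPhysics.StatisticalMechanics.LennardJonesClusters

/-!
# `OnePercentCertificate` (stmt-AtomisticToContinuum-11958), line `perron-gauge-Sketch`:
# the removal inequality for near-minimisers of the `gS`-energy

Stub `stub_nearMin_siteEnergy` of the line `perron-gauge-Sketch` for the crux `OnePercentCertificate`.
For the finite-range part `gS` of the explicit split of `ThreeConeCertificateDefs.lean`
(`gS r = V_LJ r − fS r` for `r < 5/2`, `gS r = 0` for `r ≥ 5/2`): if an injective configuration
`x` of `N` points in `ℝ³` has `gS`-energy within `ε` of the infimum `E_gS(N) = groundStateEnergy gS 3 N`,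
then every particle has site energy `∑_{k ≠ i} gS |xᵢ − x_k| < ε`.

Proof (the `ε`-version of the tree's `siteEnergy_nonpos_of_isGroundState`): move particle `i` to a
far point `y` at distance `≥ 4 > 5/2` from all particles, where `gS = 0`; the new configuration is
injective, its energy is `E_gS(x) − (site energy of i)`, and it is `≥ E_gS(N) > E_gS(x) − ε` because the
`gS`-energies are bounded below (`gS ≥ −(1/12 + 21997/10⁵)`, from `V_LJ ≥ −1/12` and `fS ≤ 21997/10⁵`).
-/

noncomputable section

open scoped BigOperators
open Literature.MathematicalPhysics.StatisticalMechanics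
open Summit.AtomisticToContinuum.Crystallization.Theorems.ThreeConeSplit

namespace Summit.AtomisticToContinuum.Crystallization.Theorems.PerronGauge

/-- `bernsteinTail T r ≥ 0` for `T ≥ 0` (nonnegative integrand on `[0, T]`). [folklore] -/
private theorem nearMin_bernsteinTail_nonneg {T : ℝ} (hT : 0 ≤ T) (r : ℝ) :
    0 ≤ bernsteinTail T r := by
  unfold bernsteinTail
  exact intervalIntegral.integral_nonneg hT fun t _ => by positivity

/-- `fS ≤ 21997/10⁵` everywhere: the two subtracted terms are nonnegative and `e^{−a r²} ≤ 1`.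
[folklore] -/
private theorem nearMin_fS_le (r : ℝ) : fS r ≤ 21997 / 100000 := by
  unfold fS
  have h1 : Real.exp (-(169 / 100) * r ^ 2) ≤ 1 :=
    Real.exp_le_one_iff.2 (by nlinarith [sq_nonneg r])
  have h2 : 0 ≤ Real.exp (-(81 / 100) * r ^ 2) := (Real.exp_pos _).le
  have h3 := nearMin_bernsteinTail_nonneg (by norm_num : (0 : ℝ) ≤ 36 / 25) r
  nlinarith

/-- `gS` is bounded below: `gS ≥ −(1/12 + 21997/10⁵)` (`V_LJ ≥ −1/12`, `fS ≤ 21997/10⁵`, and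
`gS = 0` beyond the range). [folklore] -/
private theorem nearMin_gS_lower (r : ℝ) : -(1 / 12 + 21997 / 100000) ≤ gS r := by
  unfold gS
  split_ifs
  · have h1 := neg_one_div_le_lennardJones r
    have h2 := nearMin_fS_le r
    linarith
  · norm_num

/-- **Removal inequality for near-minimisers of the `gS`-energy.** If an injective configuration of
`N` points in `ℝ³` has `gS`-energy within `ε` of the infimum `E_gS(N)`, every particle has site
energy `< ε`: move the particle beyond the range `5/2` of all others (where `gS = 0`) and compare the
energy of the resulting injective configuration with the infimum. [folklore] -/
theorem stub_nearMin_siteEnergy :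
    ∀ (N : ℕ) (x : Fin N → EuclideanSpace ℝ (Fin 3)) (ε : ℝ), Function.Injective x →
      interactionEnergy gS x < groundStateEnergy gS 3 N + ε → ∀ i, siteEnergy gS x i < ε := by
  intro N x ε hx hE i
  -- a far point `y`
  set c : ℝ := 4 + ∑ k, ‖x k‖ with hc
  set y : EuclideanSpace ℝ (Fin 3) := EuclideanSpace.single (0 : Fin 3) c with hy_def
  have hc0 : 0 ≤ c := add_nonneg (by norm_num) (Finset.sum_nonneg fun k _ => norm_nonneg (x k))
  have hyn : ‖y‖ = c := by simp [hy_def, abs_of_nonneg hc0]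
  have hy : ∀ k, 4 ≤ dist y (x k) := fun k => by
    have h1 : ‖x k‖ ≤ ∑ l, ‖x l‖ :=
      Finset.single_le_sum (f := fun l => ‖x l‖) (fun l _ => norm_nonneg _) (Finset.mem_univ k)
    have h2 : ‖y‖ - ‖x k‖ ≤ dist y (x k) := by rw [dist_eq_norm]; exact norm_sub_norm_le y (x k)
    linarith
  have hy' : ∀ k, y ≠ x k := fun k h => by
    have := hy k
    rw [h, dist_self] at this
    exact absurd this (by norm_num)
  -- the modified configuration consists of distinct points
  have hinj : Function.Injective (Function.update x i y) := by
    intro a b hab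
    by_cases ha : a = i <;> by_cases hb : b = i
    · exact ha.trans hb.symm
    · subst ha
      rw [Function.update_self, Function.update_of_ne hb] at hab
      exact absurd hab (hy' b)
    · subst hb
      rw [Function.update_self, Function.update_of_ne ha] at hab
      exact absurd hab.symm (hy' a)
    · rw [Function.update_of_ne ha, Function.update_of_ne hb] at hab
      exact hx hab
  -- its energy is at least the infimum (the `gS`-energies are bounded below)
  have hle : groundStateEnergy gS 3 N ≤ interactionEnergy gS (Function.update x i y) :=
    groundStateEnergy_le_of_le gS nearMin_gS_lower hinj
  -- the moved particle does not interact: `gS = 0` beyond `5/2`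
  have hzero : ∑ k ∈ Finset.univ.erase i, gS (dist y (x k)) = 0 :=
    Finset.sum_eq_zero fun k _ => gS_eq_zero (by linarith [hy k])
  have hdiff := sum_siteEnergy_update_sub gS x i y
  have h2 := two_mul_interactionEnergy gS x
  have h2' := two_mul_interactionEnergy gS (Function.update x i y)
  linarith

end Summit.AtomisticToContinuum.Crystallization.Theorems.PerronGauge

end
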